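import Summits.AtomisticToContinuum.Crystallization.Theorems.FrustratedLawDichotomyTwoShellRigidityCapBraceCell
import Summits.AtomisticToContinuum.Crystallization.Theorems.FrustratedLawDichotomyTwoShellRigidityLsLedgerArrow

/-!
# FrustratedLawDichotomy · two-shell rigidity — the CAP BRACE `CapBrace (7θ/2) θ Pat`, PROVED for both kissing patterns
# (decomp-a2c, lens 3 «one certified translation + split beneath», gen 35; beneath slot 3 of `OverbindingBudgetTwoShellShape`)

`CapBrace β θ Pat` (`…TwoShellRigidityLsEntry`, lens-3 g33) — «in a capped, `Pat`-isomorphic link of a `7/10`-separated injective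
configuration the two link vectors of every `√2`-pair have `|cos| ≤ β`» — is the one remaining ANALYTIC hypothesis `hB` of the tree's
ls-gauged entry arrows `lsEntryAt_fcc_of_sphericalLsFit` / `lsEntryAt_hcp_of_sphericalLsFit` (`…TwoShellRigidityLsLedgerArrow`, lens-3 g34 /
hand-1 g17), which need it at some `β ≤ 1/10`, `θ = 1/100`.  The tree's octahedral cell (`…TwoShellRigidityCells.octaCellAt`: fit constant
`18θ`, diagonal control `22θ`) only yields `β ≈ 36θ + 324θ² ≈ 0.39 > 1/10` at `θ = 1/100`.  Parts A (`…CapBraceAlg`: algebra), B (`…CapBraceCell`: `octaBrace`) and C (this file)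
prove `CapBrace (7θ/2) θ Pat` for `Pat = fcc, hcp` and all
`0 < θ ≤ 1/100` — so `β = 7/200 = 0.035` at `θ = 1/100` (the first-order truth is `3θ`), and `hB` is discharged at `β = 1/20` and `β = 1/10`.

## The octahedral brace lemma (`octaBrace`, part B)

Six points `O` (centre), `O+b, O+b'` (the `√2`-pair), `O+c, O+c'` (its two common contacts), `O+q` (the cap); the twelve cell edges
`O–x`, `x–y` (`x ∈ {b,b'}`, `y ∈ {c,c'}`), `q–x` obey the PER-SITE bond windows `nn ≤ |edge| ≤ (1+t)·nn` of BOTH endpoints among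
`O, b, b', c, c'` (the cap's own scale is not needed), and the three diagonals satisfy `|b − b'| ≥ nn_b`, `|c − c'| ≥ nn_c`, `|q| ≥ nn_O`.
Then `|⟪b, b'⟫| ≤ (7/2)·t·‖b‖‖b'‖` for `0 < t ≤ 1/100`.

Proof («exact first order + Binet–Cauchy second order»; no a-priori fit, no trigonometry, no case analysis).  Put `m = b − b'`, `n = c − c'`,
`p = b + b'`, `ρ = c + c'`, `ν = m × n`, `D = ‖ν‖² = ‖m‖²‖n‖² − ⟪m,n⟫²` (Lagrange).  Every pairing splits as `D⟪v,w⟫ = ⟪v,ν⟫⟪w,ν⟫ + Ẽ(v,w)`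
with IN-PLANE part `Ẽ(v,v) = ⟪v,m⟫²‖n‖² + ⟪v,n⟫²‖m‖² − 2⟪v,m⟫⟪v,n⟫⟪m,n⟫` (`inplane_identity`, a polynomial identity of `ℝ³`) and
`Ẽ(v,w)² ≤ Ẽ(v,v)·Ẽ(w,w)` (`proj_cs`).  By polarization the windows make `⟪q,m⟫, ⟪q,n⟫, ⟪p,m⟫, ⟪m,n⟫, ⟪p−ρ,m⟫, ⟪p−ρ,n⟫` (`≤ K`) and
`⟪p,n⟫` (`≤ 2K`) signed sums of window WIDTHS, `K = (103/50)·t·nn_O²`, EXACTLY — so every `Ẽ(v,v) ≤ A_v t²·nn_O²·D` (`inplane_le`: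
`A_q = A_{p−ρ} = 9`, `A_p = 23`; the side conditions are the rational certificates `num_q`, `num_p`).  Eliminating the three normal
components `⟪p,ν⟫, ⟪q,ν⟫, ⟪ρ,ν⟫` from the five splittings is ONE RING IDENTITY
`Q²·D·Δ = D(A−B)(QP − Q²) + QP·[(DB−QR) − (DA−QP)] + Q²·[(D‖p‖²−P²) − (D⟪p,ρ⟫−PR)]` (`A = ⟪q,p⟫`, `B = ⟪q,ρ⟫`), which pins the second-order
defect `Δ = ‖p‖² − ⟪p,ρ⟫ − ⟪q,p⟫ + ⟪q,ρ⟫` to `|Δ| ≤ (2/5)·t·nn_O²` (`delta_bound`); and `2⟪b,b'⟫ − Δ` is an exact signed sum of twelve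
window widths paired by common site, `≤ 3K` in absolute value.  Total `|⟪b,b'⟫| ≤ 3.29·t·nn_O² ≤ (7/2)·t·‖b‖‖b'‖`.

## From the cell to `CapBrace` (this file, §5–§8)

`adj_window` (a `θ`-bond lies in the window of both endpoints: `bondGraph_adj` + `nearestDist_le_dist`); the pattern fact «every `√2`-pair
has two common contacts forming a `√2`-pair» for fcc and hcp (`decide` on the integer models, transported like
`contactSeparating_scaledPattern`); `capBrace_of_squareContacts` (links and sides are bonds by `LinkIso`, cap edges by `Capped`, diagonal
lower bounds by `injective_of_linkIso` and `m ≠ i`, `nn_i ≥ 7/10 > 0` by separation; then `octaBrace`); `capBrace_fcc`, `capBrace_hcp`,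
`capBrace_mono`, and the instances `CapBrace (7/200 | 1/20 | 1/10) (1/100) (fcc | hcp)`.  §8 plugs the brace into the landed entry
arrows: `lsEntryAt_fcc_of_sphericalLsFit_braced` / `lsEntryAt_hcp_of_sphericalLsFit_braced` — `LsEntryAt Pat (…)` from a braced `Rig` run
in `SphericalLsFit (7/200) (1/100) Pat probes26 α Ω V₁ V₃` format plus decidable arithmetic, with NO analytic hypothesis left.

`[folklore]` elementary geometry of `ℝ³`; no definitions, no `sorry`, no `instance`/`notation`.
-/

noncomputable section

namespace Summit.AtomisticToContinuum.Crystallization.Theorems.FrustratedLawDichotomyTwoShellRigidityCapBrace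

open Literature.Geometry.DiscreteGeometry
open Summit.AtomisticToContinuum.Crystallization.Theorems.FrustratedLawDichotomyTwoShellRigidityCut
open Summit.AtomisticToContinuum.Crystallization.Theorems.FrustratedLawDichotomyTwoShellRigidityGaugedLadder (probes26)
open Summit.AtomisticToContinuum.Crystallization.Theorems.FrustratedLawDichotomyTwoShellRigidityLsEntry (CapBrace LsEntryAt)
open Summit.AtomisticToContinuum.Crystallization.Theorems.FrustratedLawDichotomyTwoShellRigidityLsLedger
  (SphericalLsFit slop₁ slop₃ ledgerStep aTot lsEntryAt_fcc_of_sphericalLsFit lsEntryAt_hcp_of_sphericalLsFit)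
open Summit.AtomisticToContinuum.Crystallization.Theorems.FrustratedLawDichotomyLinkIsoToolkit
  (injective_of_linkIso ne_centre_of_linkIso)
open Summit.AtomisticToContinuum.Crystallization.Theorems.FrustratedLawDichotomyCappedRigidityCertPatterns
  (dist_eq_one_iff_sqNormInt dist_eq_sqrt_two_iff_sqNormInt fcc_contactSeparating hcp_contactSeparating)
open scoped RealInnerProductSpace

/-! ## §5 Bond windows -/

/-- A `θ`-bond `j ∼ k` (`θ ≥ 0`) has `nn_j ≤ ‖y k − y j‖ ≤ (1+θ)·nn_j` and `nn_k ≤ ‖y k − y j‖ ≤ (1+θ)·nn_k`. [folklore] -/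
theorem adj_window {N : ℕ} {θ : ℝ} {y : Fin N → E3} {j k : Fin N} (hθ : 0 ≤ θ) (h : (bondGraph θ y).Adj j k) :
    (nearestDist y j ≤ ‖y k - y j‖ ∧ ‖y k - y j‖ ≤ (1 + θ) * nearestDist y j) ∧
      (nearestDist y k ≤ ‖y k - y j‖ ∧ ‖y k - y j‖ ≤ (1 + θ) * nearestDist y k) := by
  obtain ⟨hne, hle⟩ := bondGraph_adj.1 h
  have h1 : 0 ≤ 1 + θ := by linarith
  have e : ‖y k - y j‖ = dist (y j) (y k) := by rw [dist_eq_norm, norm_sub_rev]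
  rw [e]
  refine ⟨⟨nearestDist_le_dist y hne.symm, hle.trans (mul_le_mul_of_nonneg_left (min_le_left _ _) h1)⟩, ⟨?_, ?_⟩⟩
  · rw [dist_comm]; exact nearestDist_le_dist y hne
  · exact hle.trans (mul_le_mul_of_nonneg_left (min_le_right _ _) h1)

/-! ## §6 Square contacts in the two kissing patterns -/

/-- **Square contacts** transported from the integer model to the scaled pattern: if in `S` every pair at squared distance `2N` has two
common contacts at squared distance `2N` from each other, then in `scaledPattern S N` every `√2`-pair has two common contacts forming a
`√2`-pair. [folklore] -/
theorem squareContacts_scaledPattern {S : Finset (Fin 3 → ℤ)} {N : ℕ} (hN : N ≠ 0)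
    (h : ∀ v ∈ S, ∀ v' ∈ S, sqNormInt (v - v') = 2 * N → ∃ z ∈ S, ∃ z' ∈ S, sqNormInt (z - v) = N ∧ sqNormInt (z - v') = N ∧
      sqNormInt (z' - v) = N ∧ sqNormInt (z' - v') = N ∧ sqNormInt (z - z') = 2 * N) :
    ∀ u u' : ↥(scaledPattern S N), dist (u : E3) (u' : E3) = Real.sqrt 2 →
      ∃ w w' : ↥(scaledPattern S N), dist (w : E3) (u : E3) = 1 ∧ dist (w : E3) (u' : E3) = 1 ∧
        dist (w' : E3) (u : E3) = 1 ∧ dist (w' : E3) (u' : E3) = 1 ∧ dist (w : E3) (w' : E3) = Real.sqrt 2 := by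
  intro u u' huu'
  have hu := u.2
  have hu' := u'.2
  simp only [scaledPattern, Finset.mem_image] at hu hu'
  obtain ⟨v, hv, hvu⟩ := hu
  obtain ⟨v', hv', hvu'⟩ := hu'
  have hvv' : sqNormInt (v - v') = 2 * N := by
    rw [← hvu, ← hvu'] at huu'
    exact (dist_eq_sqrt_two_iff_sqNormInt hN v v').1 huu'
  obtain ⟨z, hz, z', hz', h1, h2, h3, h4, h5⟩ := h v hv v' hv' hvv'
  have hzmem : ((Real.sqrt N)⁻¹ • intVec z : E3) ∈ scaledPattern S N := by
    simp only [scaledPattern, Finset.mem_image]; exact ⟨z, hz, rfl⟩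
  have hz'mem : ((Real.sqrt N)⁻¹ • intVec z' : E3) ∈ scaledPattern S N := by
    simp only [scaledPattern, Finset.mem_image]; exact ⟨z', hz', rfl⟩
  refine ⟨⟨_, hzmem⟩, ⟨_, hz'mem⟩, ?_, ?_, ?_, ?_, ?_⟩
  · show dist ((Real.sqrt N)⁻¹ • intVec z : E3) (u : E3) = 1
    rw [← hvu]; exact (dist_eq_one_iff_sqNormInt hN z v).2 h1
  · show dist ((Real.sqrt N)⁻¹ • intVec z : E3) (u' : E3) = 1
    rw [← hvu']; exact (dist_eq_one_iff_sqNormInt hN z v').2 h2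
  · show dist ((Real.sqrt N)⁻¹ • intVec z' : E3) (u : E3) = 1
    rw [← hvu]; exact (dist_eq_one_iff_sqNormInt hN z' v).2 h3
  · show dist ((Real.sqrt N)⁻¹ • intVec z' : E3) (u' : E3) = 1
    rw [← hvu']; exact (dist_eq_one_iff_sqNormInt hN z' v').2 h4
  · show dist ((Real.sqrt N)⁻¹ • intVec z : E3) ((Real.sqrt N)⁻¹ • intVec z') = Real.sqrt 2
    exact (dist_eq_sqrt_two_iff_sqNormInt hN z z').2 h5

set_option maxRecDepth 4000 in
/-- In the integer cuboctahedron every pair at squared distance `4` is the diagonal of a square: two common contacts at squared distance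
`4` from each other. [folklore] -/
theorem fccInt_squareContacts :
    ∀ v ∈ fccInt, ∀ v' ∈ fccInt, sqNormInt (v - v') = 2 * 2 → ∃ z ∈ fccInt, ∃ z' ∈ fccInt, sqNormInt (z - v) = 2 ∧
      sqNormInt (z - v') = 2 ∧ sqNormInt (z' - v) = 2 ∧ sqNormInt (z' - v') = 2 ∧ sqNormInt (z - z') = 2 * 2 := by
  decide

set_option maxRecDepth 4000 in
/-- In the integer anticuboctahedron every pair at squared distance `36` is the diagonal of a square: two common contacts at squared
distance `36` from each other. [folklore] -/
theorem hcpInt_squareContacts :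
    ∀ v ∈ hcpInt, ∀ v' ∈ hcpInt, sqNormInt (v - v') = 2 * 18 → ∃ z ∈ hcpInt, ∃ z' ∈ hcpInt, sqNormInt (z - v) = 18 ∧
      sqNormInt (z - v') = 18 ∧ sqNormInt (z' - v) = 18 ∧ sqNormInt (z' - v') = 18 ∧ sqNormInt (z - z') = 2 * 18 := by
  decide

/-- **Square contacts in the fcc kissing pattern.** [folklore] -/
theorem fcc_squareContacts :
    ∀ u u' : ↥fccKissingPattern, dist (u : E3) (u' : E3) = Real.sqrt 2 →
      ∃ w w' : ↥fccKissingPattern, dist (w : E3) (u : E3) = 1 ∧ dist (w : E3) (u' : E3) = 1 ∧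
        dist (w' : E3) (u : E3) = 1 ∧ dist (w' : E3) (u' : E3) = 1 ∧ dist (w : E3) (w' : E3) = Real.sqrt 2 :=
  squareContacts_scaledPattern two_ne_zero fccInt_squareContacts

/-- **Square contacts in the hcp kissing pattern.** [folklore] -/
theorem hcp_squareContacts :
    ∀ u u' : ↥hcpKissingPattern, dist (u : E3) (u' : E3) = Real.sqrt 2 →
      ∃ w w' : ↥hcpKissingPattern, dist (w : E3) (u : E3) = 1 ∧ dist (w : E3) (u' : E3) = 1 ∧
        dist (w' : E3) (u : E3) = 1 ∧ dist (w' : E3) (u' : E3) = 1 ∧ dist (w : E3) (w' : E3) = Real.sqrt 2 :=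
  squareContacts_scaledPattern (by norm_num) hcpInt_squareContacts

/-! ## §7 The cap brace -/

/-- **The cap brace for a general pattern.**  If the contact graph of `Pat` separates points and every `√2`-pair of `Pat` has two common
contacts forming a `√2`-pair, then `CapBrace (7θ/2) θ Pat` for `0 < θ ≤ 1/100`: in a capped `Pat`-isomorphic link the two link vectors of
a `√2`-pair have `|cos| ≤ 7θ/2`.  Proof: the six sites `i, τ u, τ v, τ w, τ w', m` form the octahedral cell of `octaBrace`. [folklore] -/
theorem capBrace_of_squareContacts {θ : ℝ} {Pat : Finset E3} (hθ0 : 0 < θ) (hθ : θ ≤ 1 / 100)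
    (hsep : ∀ u v : ↥Pat, u ≠ v → ∃ w : ↥Pat, dist (u : E3) (w : E3) = 1 ∧ dist (v : E3) (w : E3) ≠ 1)
    (hsq : ∀ u v : ↥Pat, dist (u : E3) (v : E3) = Real.sqrt 2 →
      ∃ w w' : ↥Pat, dist (w : E3) (u : E3) = 1 ∧ dist (w : E3) (v : E3) = 1 ∧
        dist (w' : E3) (u : E3) = 1 ∧ dist (w' : E3) (v : E3) = 1 ∧ dist (w : E3) (w' : E3) = Real.sqrt 2) :
    CapBrace (7 / 2 * θ) θ Pat := by
  intro N y i τ _hy hysep hL hC u v huv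
  obtain ⟨w, w', hwu, hwv, hw'u, hw'v, hww'⟩ := hsq u v huv
  obtain ⟨m, hmi, hm⟩ := hC u v huv
  have hτ : Function.Injective τ := injective_of_linkIso hsep hL
  have h2 : (0 : ℝ) < Real.sqrt 2 := Real.sqrt_pos.2 (by norm_num)
  have huv' : u ≠ v := by
    rintro rfl
    rw [dist_self] at huv
    exact h2.ne huv
  have hww'' : w ≠ w' := by
    rintro rfl
    rw [dist_self] at hww'
    exact h2.ne hww'
  -- the twelve bonds of the cell
  have aOb : (bondGraph θ y).Adj i (τ u) := hL.1 u
  have aOb' : (bondGraph θ y).Adj i (τ v) := hL.1 v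
  have aOc : (bondGraph θ y).Adj i (τ w) := hL.1 w
  have aOc' : (bondGraph θ y).Adj i (τ w') := hL.1 w'
  have acb : (bondGraph θ y).Adj (τ w) (τ u) := (hL.2.2 w u).2 hwu
  have ac'b : (bondGraph θ y).Adj (τ w') (τ u) := (hL.2.2 w' u).2 hw'u
  have acb' : (bondGraph θ y).Adj (τ w) (τ v) := (hL.2.2 w v).2 hwv
  have ac'b' : (bondGraph θ y).Adj (τ w') (τ v) := (hL.2.2 w' v).2 hw'v
  have abq : (bondGraph θ y).Adj (τ u) m := (hm u (Or.inl rfl)).symm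
  have ab'q : (bondGraph θ y).Adj (τ v) m := (hm v (Or.inr (Or.inl rfl))).symm
  have acq : (bondGraph θ y).Adj (τ w) m := (hm w (Or.inr (Or.inr ⟨hwu, hwv⟩))).symm
  have ac'q : (bondGraph θ y).Adj (τ w') m := (hm w' (Or.inr (Or.inr ⟨hw'u, hw'v⟩))).symm
  -- `nn_i > 0` by separation
  have hd : 0 < nearestDist y i :=
    lt_of_lt_of_le (by norm_num) (le_nearestDist (c := 7 / 10) ⟨τ u, ne_centre_of_linkIso hL u⟩
      fun k hk => hysep i k (Ne.symm hk))
  -- relative vectors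
  have ebc : ‖y (τ u) - y i - (y (τ w) - y i)‖ = ‖y (τ u) - y (τ w)‖ := by rw [sub_sub_sub_cancel_right]
  have ebc' : ‖y (τ u) - y i - (y (τ w') - y i)‖ = ‖y (τ u) - y (τ w')‖ := by rw [sub_sub_sub_cancel_right]
  have eb'c : ‖y (τ v) - y i - (y (τ w) - y i)‖ = ‖y (τ v) - y (τ w)‖ := by rw [sub_sub_sub_cancel_right]
  have eb'c' : ‖y (τ v) - y i - (y (τ w') - y i)‖ = ‖y (τ v) - y (τ w')‖ := by rw [sub_sub_sub_cancel_right]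
  have eqb : ‖y m - y i - (y (τ u) - y i)‖ = ‖y m - y (τ u)‖ := by rw [sub_sub_sub_cancel_right]
  have eqb' : ‖y m - y i - (y (τ v) - y i)‖ = ‖y m - y (τ v)‖ := by rw [sub_sub_sub_cancel_right]
  have eqc : ‖y m - y i - (y (τ w) - y i)‖ = ‖y m - y (τ w)‖ := by rw [sub_sub_sub_cancel_right]
  have eqc' : ‖y m - y i - (y (τ w') - y i)‖ = ‖y m - y (τ w')‖ := by rw [sub_sub_sub_cancel_right]
  have ebb' : ‖y (τ u) - y i - (y (τ v) - y i)‖ = ‖y (τ u) - y (τ v)‖ := by rw [sub_sub_sub_cancel_right]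
  have ecc' : ‖y (τ w) - y i - (y (τ w') - y i)‖ = ‖y (τ w) - y (τ w')‖ := by rw [sub_sub_sub_cancel_right]
  -- the three diagonals are at least a nearest-neighbour distance
  have hDb : nearestDist y (τ u) ≤ ‖y (τ u) - y i - (y (τ v) - y i)‖ := by
    rw [ebb', ← dist_eq_norm]; exact nearestDist_le_dist y (hτ.ne huv').symm
  have hDc : nearestDist y (τ w) ≤ ‖y (τ w) - y i - (y (τ w') - y i)‖ := by
    rw [ecc', ← dist_eq_norm]; exact nearestDist_le_dist y (hτ.ne hww'').symm
  have hDq : nearestDist y i ≤ ‖y m - y i‖ := by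
    rw [← dist_eq_norm, dist_comm]; exact nearestDist_le_dist y hmi
  exact octaBrace (t := θ) (d := nearestDist y i) (nb := nearestDist y (τ u)) (nb' := nearestDist y (τ v))
    (nc := nearestDist y (τ w)) (nc' := nearestDist y (τ w')) (b := y (τ u) - y i) (b' := y (τ v) - y i)
    (c := y (τ w) - y i) (c' := y (τ w') - y i) (q := y m - y i) hθ0 hθ hd
    (adj_window hθ0.le aOb).1 (adj_window hθ0.le aOb').1 (adj_window hθ0.le aOc).1 (adj_window hθ0.le aOc').1
    (adj_window hθ0.le aOb).2 (adj_window hθ0.le aOb').2 (adj_window hθ0.le aOc).2 (adj_window hθ0.le aOc').2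
    (by rw [ebc]; exact (adj_window hθ0.le acb).2) (by rw [ebc]; exact (adj_window hθ0.le acb).1)
    (by rw [ebc']; exact (adj_window hθ0.le ac'b).2) (by rw [ebc']; exact (adj_window hθ0.le ac'b).1)
    (by rw [eb'c]; exact (adj_window hθ0.le acb').2) (by rw [eb'c]; exact (adj_window hθ0.le acb').1)
    (by rw [eb'c']; exact (adj_window hθ0.le ac'b').2) (by rw [eb'c']; exact (adj_window hθ0.le ac'b').1)
    (by rw [eqb]; exact (adj_window hθ0.le abq).1) (by rw [eqb']; exact (adj_window hθ0.le ab'q).1)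
    (by rw [eqc]; exact (adj_window hθ0.le acq).1) (by rw [eqc']; exact (adj_window hθ0.le ac'q).1)
    hDb hDc hDq

/-- `CapBrace` is monotone in `β`. [folklore] -/
theorem capBrace_mono {β β' θ : ℝ} {Pat : Finset E3} (hβ : β ≤ β') (h : CapBrace β θ Pat) : CapBrace β' θ Pat := by
  intro N y i τ hy hysep hL hC u v huv
  exact (h N y i τ hy hysep hL hC u v huv).trans (mul_le_mul_of_nonneg_right hβ (by positivity))

/-- **The fcc cap brace**: `CapBrace (7θ/2) θ fccKissingPattern` for `0 < θ ≤ 1/100`. [folklore] -/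
theorem capBrace_fcc {θ : ℝ} (hθ0 : 0 < θ) (hθ : θ ≤ 1 / 100) : CapBrace (7 / 2 * θ) θ fccKissingPattern :=
  capBrace_of_squareContacts hθ0 hθ fcc_contactSeparating fcc_squareContacts

/-- **The hcp cap brace**: `CapBrace (7θ/2) θ hcpKissingPattern` for `0 < θ ≤ 1/100`. [folklore] -/
theorem capBrace_hcp {θ : ℝ} (hθ0 : 0 < θ) (hθ : θ ≤ 1 / 100) : CapBrace (7 / 2 * θ) θ hcpKissingPattern :=
  capBrace_of_squareContacts hθ0 hθ hcp_contactSeparating hcp_squareContacts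

/-! ### At the route's tolerance `θ = 1/100` -/

/-- `CapBrace (7/200) (1/100) fccKissingPattern` — `|cos| ≤ 0.035`. [folklore] -/
theorem capBrace_fcc_hundredth : CapBrace (7 / 200) (1 / 100) fccKissingPattern := by
  have h := capBrace_fcc (θ := 1 / 100) (by norm_num) le_rfl
  norm_num at h
  exact h

/-- `CapBrace (7/200) (1/100) hcpKissingPattern` — `|cos| ≤ 0.035`. [folklore] -/
theorem capBrace_hcp_hundredth : CapBrace (7 / 200) (1 / 100) hcpKissingPattern := by
  have h := capBrace_hcp (θ := 1 / 100) (by norm_num) le_rfl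
  norm_num at h
  exact h

/-- The entry arrows' hypothesis `hB` at `β = 1/20`, fcc. [folklore] -/
theorem capBrace_fcc_twentieth : CapBrace (1 / 20) (1 / 100) fccKissingPattern :=
  capBrace_mono (by norm_num) capBrace_fcc_hundredth

/-- The entry arrows' hypothesis `hB` at `β = 1/20`, hcp. [folklore] -/
theorem capBrace_hcp_twentieth : CapBrace (1 / 20) (1 / 100) hcpKissingPattern :=
  capBrace_mono (by norm_num) capBrace_hcp_hundredth

/-- The entry arrows' hypothesis `hB` at `β = 1/10`, fcc. [folklore] -/
theorem capBrace_fcc_tenth : CapBrace (1 / 10) (1 / 100) fccKissingPattern :=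
  capBrace_mono (by norm_num) capBrace_fcc_hundredth

/-- The entry arrows' hypothesis `hB` at `β = 1/10`, hcp. [folklore] -/
theorem capBrace_hcp_tenth : CapBrace (1 / 10) (1 / 100) hcpKissingPattern :=
  capBrace_mono (by norm_num) capBrace_hcp_hundredth

/-! ## §8 The entry arrows with the brace discharged (`β = 7/200`) -/

/-- ★★★ **`LsEntryAt fcc P` from a braced `Rig` run alone**: the landed arrow `lsEntryAt_fcc_of_sphericalLsFit` with its hypothesis
`hB : CapBrace β (1/100) fcc` discharged at `β = 7/200` by `capBrace_fcc_hundredth`. [folklore] -/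
theorem lsEntryAt_fcc_of_sphericalLsFit_braced {α Ω V₁ V₃ K T : ℝ} {k : ℕ}
    (hS : SphericalLsFit (7 / 200) (1 / 100) fccKissingPattern probes26 α Ω V₁ V₃) (hα : 0 ≤ α)
    (hK0 : 0 ≤ K) (hKθ : (K + 2 + 1 / 100) * (1 / 100) ≤ 1 / 5)
    (hT : (ledgerStep (Ω + 3 / 2 * (1 / 100 * α)) (aTot (1 / 100) α))^[k] (3465 / 1000 * aTot (1 / 100) α) ≤ T)
    (hK : 11281 / 10000 * (V₁ + slop₁ (1 / 100) α T) ≤ K * (1 / 100)) :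
    LsEntryAt fccKissingPattern
      (V₁ + slop₁ (1 / 100) α T, (2 * (K + 2 + 1 / 100) + (K + 2 + 1 / 100) ^ 2 * (1 / 100)) * (1 / 100),
        V₃ + slop₃ (1 / 100) α T, (2 * (K + 2 + 1 / 100) + (K + 2 + 1 / 100) ^ 2 * (1 / 100) + K) * (1 / 100)) :=
  lsEntryAt_fcc_of_sphericalLsFit capBrace_fcc_hundredth hS hα hK0 hKθ hT hK

/-- ★★★ the same at **hcp**. [folklore] -/
theorem lsEntryAt_hcp_of_sphericalLsFit_braced {α Ω V₁ V₃ K T : ℝ} {k : ℕ}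
    (hS : SphericalLsFit (7 / 200) (1 / 100) hcpKissingPattern probes26 α Ω V₁ V₃) (hα : 0 ≤ α)
    (hK0 : 0 ≤ K) (hKθ : (K + 2 + 1 / 100) * (1 / 100) ≤ 1 / 5)
    (hT : (ledgerStep (Ω + 3 / 2 * (1 / 100 * α)) (aTot (1 / 100) α))^[k] (3465 / 1000 * aTot (1 / 100) α) ≤ T)
    (hK : 11281 / 10000 * (V₁ + slop₁ (1 / 100) α T) ≤ K * (1 / 100)) :
    LsEntryAt hcpKissingPattern
      (V₁ + slop₁ (1 / 100) α T, (2 * (K + 2 + 1 / 100) + (K + 2 + 1 / 100) ^ 2 * (1 / 100)) * (1 / 100),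
        V₃ + slop₃ (1 / 100) α T, (2 * (K + 2 + 1 / 100) + (K + 2 + 1 / 100) ^ 2 * (1 / 100) + K) * (1 / 100)) :=
  lsEntryAt_hcp_of_sphericalLsFit capBrace_hcp_hundredth hS hα hK0 hKθ hT hK


end Summit.AtomisticToContinuum.Crystallization.Theorems.FrustratedLawDichotomyTwoShellRigidityCapBrace

end
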